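import Literature.NumberTheory.LocalFields.UnramifiedQuadraticOrderUnitIndex      -- ★ p840757 (F0P2-p06): the subgroup `{u : σ u − u ∈ 𝔪^k}` as `comap eqLocus`, `mem_comap_eqLocus_iff`
import HarnessLib

/-!
# The RAMIFIED quadratic order unit index `[S^× : {u : σ u ≡ u (𝔪^{2j+1})}] = q^j` — Mars' index `[R_L^× : R_L(j)^×]` for `e = 2`
# (Flicker, *Elementary proof of the fundamental lemma for a unitary group* (1998), Prop. 7 p. 84 and §6 p. 95 REMARK; Serre, *Local Fields*, Ch. IV §1, Ch. V §1)

Topic `NumberTheory/LocalFields`, namespace `Literature.NumberTheory.LocalFields.RamifiedQuadraticOrder`.  THEOREMS ONLY: no definition, no named fact, no instance,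
no notation, no `sorry`.  Cell `pub/hodgecm-mathlib`, F0∕P3a road «D-N7-inert» COUNT programme, MAP v3 §2 (F3) «H-decompositions + order indices», sub-brick **(F3b)
RAMIFIED ORDER INDEX** (LEAD F0P3a-plan (g9) T8-49 (C); heir of F0P2-p06 (g5), HANDOFF-F3 1c13736d §REMAINING 2: «(F3a)'s hypothesis `IsUnit (σ a − a)` IS unramifiedness;
the ramified count differs in kind»).  Consumers: B-p10 (g24) (F9)-ramified ∕ B-p14 (g30) (F11-c∕d): the ramified H-side weight `Σ_{j ≤ N} q^j = (q^{N+1} − 1)∕(q − 1)`.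
HC_CM is proved only modulo the printed citations until rung 0 closes; nothing printed is a letter here — elementary DVR algebra.

THE PRINT.  [Flicker1998UnitaryFL §6 p. 95 REMARK (Mars)]: «`[R_E^× : R_E(j)^×]` is `1` if `j = 0` and `q^{j+1−f}(q^f − 1)∕(q − 1)` if `j > 0` … the integral equals
`(q^N(q+1) − 2)∕(q−1)` if `e = 1`, and `(q^{N+1} − 1)∕(q − 1)` if `e = 2`»; [Prop. 7 p. 84]: «`[(R + √π R)¹ : (R + √π π^j R)¹] = q^j` … `u² − πδ² = 1` implies
`u = ±(1 + πδ²∕2 + ⋯)`».  IN-HOUSE, σ-INTRINSICALLY, in the currency of ★ `UnramifiedQuadraticOrderUnitIndex` (F0P2-p06): `S` a DVR (model `R_L = 𝒪_{EL_w}`) with an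
involution `σ` which is RESIDUALLY TRIVIAL (`σ x − x ∈ 𝔪` for ALL `x` — the ramified case; (F3a)'s `IsUnit (σ a − a)` is exactly what fails), an ANTI-FIXED uniformiser
`ϖ` (`σ ϖ = −ϖ`, tame) and `2 ∈ S^×`; the order `R_L(j) = R + ϖ_R^j R_L = R ⊕ R ϖ·ϖ_R^j` (`R = S^σ`, `ϖ_R = ϖ²`) has unit group
`{u ∈ S^× : σ u − u ∈ 𝔪^{2j+1}}` = ★'s `comap eqLocus` subgroup at level `2j + 1`, and
**`index_comap_eqLocus_odd_eq_pow : [S^× : {σ u ≡ u (𝔪^{2j+1})}] = q^j`**, `q = |𝓀_S|`.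

* §1 STRUCTURE: `mem_maximalIdeal_of_map_eq_neg` (anti-fixed ⇒ `∈ 𝔪`), **`exists_fixed_add_fixed_mul`** (`S = S^σ + S^σ ϖ`), `fixed_coords_unique`,
  `pow_succ_dvd_of_odd_pow_dvd_of_fixed` (FIXED ELEMENTS HAVE EVEN VALUATION).
* §2 THE TWISTED LOGARITHM `w(x) = (x − σx)(x + σx)⁻¹` (as `(x - σ x) * Ring.inverse (x + σ x)`): `isUnit_add_map_self`, `sub_map_mul_inverse_mem_pow_iff`
  (`w(x) ∈ 𝔪^k ⟺ σx − x ∈ 𝔪^k`), `map_sub_self_mem_pow_succ_of_even` (PARITY `𝔪^{2i+2} ⇒ 𝔪^{2i+3}`), **`twistedLog_mul_sub_mem`**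
  (`w(uu′) − w(u) − w(u′) ∈ 𝔪^{2k}` when `σu − u, σu′ − u′ ∈ 𝔪^k` — the identity `2(M P₁P₂ − M₁PP₂ − M₂PP₁) = −M₁M₂(M₁P₂ + M₂P₁)`).
* §3 THE INDEX: `exists_isUnit_twistedLog_sub_mem` (every class of `𝔪^{2j+1}∕𝔪^{2j+2}` is a `w(1 + ϖ^{2j+1} r₀)`), `natCard_map_mk_maximalIdeal_pow`
  (`|𝔪^n ∕ 𝔪^{n+1}| = |𝓀|`, ★ `natCard_quotient_maximalIdeal_pow` + `DoubleQuot.quotQuotEquivQuotOfLE`), `index_comap_eqLocus_one_eq_one` (level `1`: everything),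
  **`relIndex_comap_eqLocus_odd`** (`[V_{2j+1} : V_{2j+3}] = |𝓀|`: `w` is a homomorphism `V_{2j+1} → 𝔪^{2j+1}∕𝔪^{2j+2}` ONTO, kernel `V_{2j+2} = V_{2j+3}`), and the
  HEAD **`index_comap_eqLocus_odd_eq_pow`** by induction (`Subgroup.relIndex_mul_index`).
NOT here: the norm-one version `[R_L¹ : R_L(j)¹] = q^j` (Prop. 7 (b) verbatim) — same filtration argument on the norm-one subgroup, cut on request; the instantiation
at `S = 𝒪_{EL_w}` ((F11) frame, B-p14).

## References
* [Flicker1998UnitaryFL] Y. Z. Flicker, *Elementary proof of the fundamental lemma for a unitary group*, Canad. J. Math. 50 (1998), Prop. 7 p. 84, §6 p. 95 REMARK.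
* [Serre1979] J.-P. Serre, *Local Fields* (1979), Ch. IV §1 Prop. 3, Ch. V §1.
-/

set_option autoImplicit false

namespace Literature.NumberTheory.LocalFields.RamifiedQuadraticOrder

open IsLocalRing Literature.NumberTheory.LocalFields.UnramifiedQuadraticNorm

universe u

variable {S : Type u} [CommRing S] (σ : S →+* S)

/-! ## §1 The ramified involution: `S = S^σ ⊕ S^σ·ϖ`, anti-fixed elements lie in `𝔪`, fixed elements have even valuation -/

section Structure

variable [IsDomain S] [IsDiscreteValuationRing S] (hσ : ∀ x, σ (σ x) = x) (hres : ∀ x, σ x - x ∈ maximalIdeal S)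
  {ϖ : S} (hϖ : Irreducible ϖ) (hσϖ : σ ϖ = -ϖ) (h2 : IsUnit (2 : S))

include hres h2 in
/-- For a RESIDUALLY TRIVIAL involution (`σ x ≡ x (mod 𝔪)` for all `x`) with `2` a unit, every ANTI-fixed element lies in `𝔪` (`σ c − c = −2c`).
[cite: Serre1979, Ch. IV §1 Prop. 3] [cite: Flicker1998UnitaryFL, Prop. 7 p. 84] -/
theorem mem_maximalIdeal_of_map_eq_neg {c : S} (hc : σ c = -c) : c ∈ maximalIdeal S := by
  have h : σ c - c = -(2 * c) := by rw [hc]; ring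
  have h' : 2 * c ∈ maximalIdeal S := by rw [← neg_mem_iff, ← h]; exact hres c
  exact (Ideal.unit_mul_mem_iff_mem _ h2).1 h'

include hσ hres hϖ hσϖ h2 in
/-- **`S = S^σ + S^σ·ϖ`**: with an anti-fixed uniformiser `ϖ` (`σ ϖ = −ϖ`) every `x` is `a + b ϖ` with `a, b` `σ`-FIXED (`a = (x + σx)∕2`, `(x − σx)∕2 = b ϖ`).
[cite: Serre1979, Ch. IV §1 Prop. 3] [cite: Flicker1998UnitaryFL, Prop. 7 p. 84] -/
theorem exists_fixed_add_fixed_mul (x : S) : ∃ a b : S, σ a = a ∧ σ b = b ∧ x = a + b * ϖ := by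
  obtain ⟨t, ht⟩ := h2.exists_left_inv   -- `t * 2 = 1`
  have hσt : σ t = t := by
    have h1 : σ t * 2 = 1 := by have := congrArg σ ht; rwa [map_mul, map_ofNat, map_one] at this
    have h3 : σ t * 2 = t * 2 := by rw [h1, ht]
    exact mul_right_cancel₀ h2.ne_zero h3
  -- the anti-fixed part lies in `𝔪 = (ϖ)`
  have hanti : σ ((x - σ x) * t) = -((x - σ x) * t) := by rw [map_mul, map_sub, hσ, hσt]; ring
  have hmem := mem_maximalIdeal_of_map_eq_neg σ hres h2 hanti
  rw [(IsDiscreteValuationRing.irreducible_iff_uniformizer ϖ).1 hϖ, Ideal.mem_span_singleton'] at hmem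
  obtain ⟨b, hb⟩ := hmem
  refine ⟨(x + σ x) * t, b, by rw [map_mul, map_add, hσ, hσt, add_comm], ?_, ?_⟩
  · -- `σ b · (−ϖ) = −(b ϖ)` ⇒ `σ b = b`
    have h1 : σ b * ϖ = b * ϖ := by
      have := congrArg σ hb
      rw [map_mul, hσϖ, hanti, ← hb] at this
      linear_combination -this
    exact mul_right_cancel₀ hϖ.ne_zero h1
  · rw [hb]; linear_combination -(x * ht)

omit [IsDiscreteValuationRing S] in
include hσϖ in
/-- UNIQUENESS of the coordinates: `a + b ϖ = a′ + b′ ϖ` with all four `σ`-fixed forces `a = a′` and `b = b′` (`2` a non-zero-divisor suffices: domain, `2 ≠ 0`).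
[cite: Serre1979, Ch. IV §1 Prop. 3] -/
theorem fixed_coords_unique (h2 : (2 : S) ≠ 0) (hϖ0 : ϖ ≠ 0) {a b a' b' : S} (ha : σ a = a) (hb : σ b = b) (ha' : σ a' = a') (hb' : σ b' = b')
    (h : a + b * ϖ = a' + b' * ϖ) : a = a' ∧ b = b' := by
  have hσh : a - b * ϖ = a' - b' * ϖ := by
    have := congrArg σ h
    rw [map_add, map_add, map_mul, map_mul, ha, hb, ha', hb', hσϖ] at this
    linear_combination this
  have hbb : b = b' := by
    have h3 : 2 * (b * ϖ) = 2 * (b' * ϖ) := by linear_combination h - hσh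
    exact mul_right_cancel₀ hϖ0 (mul_left_cancel₀ h2 h3)
  refine ⟨?_, hbb⟩
  rw [hbb] at h
  exact add_right_cancel h

include hres hσϖ h2 in
/-- **FIXED ELEMENTS HAVE EVEN VALUATION**: if `σ b = b` and `ϖ^{2i+1} ∣ b` then `ϖ^{2i+2} ∣ b` (`b = ϖ^{2i+1} d` forces `σ d = −d`, so `d ∈ 𝔪`).
[cite: Serre1979, Ch. IV §1 Prop. 3] [cite: Flicker1998UnitaryFL, Prop. 7 p. 84] -/
theorem pow_succ_dvd_of_odd_pow_dvd_of_fixed (hϖ : Irreducible ϖ) {b : S} (hb : σ b = b) {i : ℕ} (h : ϖ ^ (2 * i + 1) ∣ b) : ϖ ^ (2 * i + 2) ∣ b := by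
  obtain ⟨d, rfl⟩ := h
  have hσpow : σ (ϖ ^ (2 * i + 1)) = -ϖ ^ (2 * i + 1) := by
    rw [map_pow, hσϖ, neg_pow, pow_succ (-1 : S), pow_mul, neg_one_sq, one_pow, one_mul, neg_one_mul]
  have hd : σ d = -d := by
    have h1 : ϖ ^ (2 * i + 1) * σ d = ϖ ^ (2 * i + 1) * (-d) := by
      have := hb
      rw [map_mul, hσpow] at this
      linear_combination -this
    exact mul_left_cancel₀ (pow_ne_zero _ hϖ.ne_zero) h1
  have hdm := mem_maximalIdeal_of_map_eq_neg σ hres h2 hd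
  rw [(IsDiscreteValuationRing.irreducible_iff_uniformizer ϖ).1 hϖ, Ideal.mem_span_singleton] at hdm
  obtain ⟨e, rfl⟩ := hdm
  exact ⟨e, by ring⟩

end Structure

/-! ## §2 The twisted logarithm `w(x) = (x − σx)(x + σx)⁻¹` on units -/

section TwistedLog

variable [IsDomain S] [IsDiscreteValuationRing S] (hσ : ∀ x, σ (σ x) = x) (hres : ∀ x, σ x - x ∈ maximalIdeal S)
  {ϖ : S} (hϖ : Irreducible ϖ) (hσϖ : σ ϖ = -ϖ) (h2 : IsUnit (2 : S))

include hres h2 in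
/-- For a unit `x`, `x + σx = 2x + (σx − x)` is a unit (residually trivial `σ`, `2 ∈ S^×`). [cite: Serre1979, Ch. IV §1 Prop. 3] -/
theorem isUnit_add_map_self {x : S} (hx : IsUnit x) : IsUnit (x + σ x) := by
  by_contra h
  have hm : x + σ x ∈ maximalIdeal S := (IsLocalRing.mem_maximalIdeal _).2 h
  have h2x : 2 * x ∈ maximalIdeal S := by
    have := sub_mem hm (hres x)
    convert this using 1; ring
  exact (IsLocalRing.mem_maximalIdeal _).1 ((Ideal.unit_mul_mem_iff_mem _ h2).1 h2x) hx

include hres h2 in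
/-- `w(x) = (x − σx)·(x + σx)⁻¹ ∈ 𝔪^k ⟺ σx − x ∈ 𝔪^k` for a unit `x`. [cite: Serre1979, Ch. IV §1 Prop. 3] -/
theorem sub_map_mul_inverse_mem_pow_iff {x : S} (hx : IsUnit x) (k : ℕ) :
    (x - σ x) * Ring.inverse (x + σ x) ∈ maximalIdeal S ^ k ↔ σ x - x ∈ maximalIdeal S ^ k := by
  have hp := isUnit_add_map_self σ hres h2 hx
  rw [show σ x - x = -((x - σ x) * Ring.inverse (x + σ x) * (x + σ x)) by rw [Ring.inverse_mul_cancel_right _ _ hp]; ring, neg_mem_iff,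
    Ideal.mul_unit_mem_iff_mem _ hp]

include hσ hres hϖ hσϖ h2 in
/-- **Parity**: `σx − x ∈ 𝔪^{2i+2} ⇒ σx − x ∈ 𝔪^{2i+3}` (in coordinates `σx − x = −2bϖ` with `b` fixed of EVEN valuation). [cite: Flicker1998UnitaryFL, Prop. 7 p. 84] -/
theorem map_sub_self_mem_pow_succ_of_even (x : S) (i : ℕ) (h : σ x - x ∈ maximalIdeal S ^ (2 * i + 2)) : σ x - x ∈ maximalIdeal S ^ (2 * i + 3) := by
  obtain ⟨a, b, ha, hb, rfl⟩ := exists_fixed_add_fixed_mul σ hσ hres hϖ hσϖ h2 x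
  have hm : maximalIdeal S = Ideal.span {ϖ} := (IsDiscreteValuationRing.irreducible_iff_uniformizer ϖ).1 hϖ
  have e : σ (a + b * ϖ) - (a + b * ϖ) = -(2 * (b * ϖ)) := by rw [map_add, map_mul, ha, hb, hσϖ]; ring
  rw [e, neg_mem_iff, Ideal.unit_mul_mem_iff_mem _ h2, hm, Ideal.span_singleton_pow, Ideal.mem_span_singleton] at h ⊢
  have hb' : ϖ ^ (2 * i + 1) ∣ b := by
    rw [pow_succ] at h
    exact (mul_dvd_mul_iff_right hϖ.ne_zero).1 h
  obtain ⟨d, hd⟩ := pow_succ_dvd_of_odd_pow_dvd_of_fixed σ hres hσϖ h2 hϖ hb hb'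
  rw [hd]
  exact ⟨d, by ring⟩

include hres h2 in
/-- **The twisted logarithm is a homomorphism modulo squares of the conductor**: for units `u, u′` with `σu − u, σu′ − u′ ∈ 𝔪^k`,
`w(u u′) − w(u) − w(u′) ∈ 𝔪^{2k}` — from the exact identity `2 (M P₁P₂ − M₁ P P₂ − M₂ P P₁) = −M₁M₂(M₁P₂ + M₂P₁)` (`P = x + σx`, `M = x − σx`).
[cite: Serre1979, Ch. IV §1 Prop. 3] [cite: Flicker1998UnitaryFL, Prop. 7 p. 84] -/
theorem twistedLog_mul_sub_mem {u u' : S} (hu : IsUnit u) (hu' : IsUnit u') (k : ℕ) (hk : σ u - u ∈ maximalIdeal S ^ k)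
    (hk' : σ u' - u' ∈ maximalIdeal S ^ k) :
    (u * u' - σ (u * u')) * Ring.inverse (u * u' + σ (u * u')) - (u - σ u) * Ring.inverse (u + σ u) -
        (u' - σ u') * Ring.inverse (u' + σ u') ∈ maximalIdeal S ^ (2 * k) := by
  have hP := isUnit_add_map_self σ hres h2 (hu.mul hu')
  have hP₁ := isUnit_add_map_self σ hres h2 hu
  have hP₂ := isUnit_add_map_self σ hres h2 hu'
  set X := (u * u' - σ (u * u')) * Ring.inverse (u * u' + σ (u * u')) - (u - σ u) * Ring.inverse (u + σ u) -
        (u' - σ u') * Ring.inverse (u' + σ u') with hX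
  -- clear denominators
  have key : 2 * X * ((u * u' + σ (u * u')) * (u + σ u) * (u' + σ u')) = -((σ u - u) * (σ u' - u') * ((u - σ u) * (u' + σ u') + (u' - σ u') * (u + σ u))) := by
    have e1 := Ring.inverse_mul_cancel _ hP
    have e2 := Ring.inverse_mul_cancel _ hP₁
    have e3 := Ring.inverse_mul_cancel _ hP₂
    rw [hX, map_mul]
    rw [map_mul] at e1
    linear_combination (2 * (u * u' - σ u * σ u') * ((u + σ u) * (u' + σ u'))) * e1
      - (2 * (u - σ u) * ((u * u' + σ u * σ u') * (u' + σ u'))) * e2 - (2 * (u' - σ u') * ((u * u' + σ u * σ u') * (u + σ u))) * e3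
  have hmem : 2 * X * ((u * u' + σ (u * u')) * (u + σ u) * (u' + σ u')) ∈ maximalIdeal S ^ (2 * k) := by
    rw [key, neg_mem_iff, two_mul, pow_add]
    exact Ideal.mul_mem_right _ _ (Ideal.mul_mem_mul hk hk')
  rwa [Ideal.mul_unit_mem_iff_mem _ ((hP.mul hP₁).mul hP₂), Ideal.unit_mul_mem_iff_mem _ h2] at hmem

end TwistedLog

/-! ## §3 The index `[S^× : {u : σ u ≡ u (𝔪^{2j+1})}] = q^j` -/

section Index

variable [IsDomain S] [IsDiscreteValuationRing S] (hσ : ∀ x, σ (σ x) = x) (hres : ∀ x, σ x - x ∈ maximalIdeal S)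
  {ϖ : S} (hϖ : Irreducible ϖ) (hσϖ : σ ϖ = -ϖ) (h2 : IsUnit (2 : S))

include hσ hres hϖ hσϖ h2 in
/-- **Every class of `𝔪^{2j+1} ∕ 𝔪^{2j+2}` is a twisted logarithm**: for `m ∈ 𝔪^{2j+1}` there is a unit `u = 1 + ϖ^{2j+1} r₀` (`r₀` fixed) with `σu − u ∈ 𝔪^{2j+1}` and
`w(u) − m ∈ 𝔪^{2j+2}`. [cite: Flicker1998UnitaryFL, Prop. 7 p. 84] [cite: Serre1979, Ch. IV §1 Prop. 3] -/
theorem exists_isUnit_twistedLog_sub_mem (j : ℕ) {m : S} (hm : m ∈ maximalIdeal S ^ (2 * j + 1)) :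
    ∃ u : S, IsUnit u ∧ σ u - u ∈ maximalIdeal S ^ (2 * j + 1) ∧ (u - σ u) * Ring.inverse (u + σ u) - m ∈ maximalIdeal S ^ (2 * j + 2) := by
  have hmax : maximalIdeal S = Ideal.span {ϖ} := (IsDiscreteValuationRing.irreducible_iff_uniformizer ϖ).1 hϖ
  obtain ⟨t, ht⟩ := h2.exists_left_inv   -- `t * 2 = 1`
  have hσt : σ t = t := by
    have h1 : σ t * 2 = 1 := by have := congrArg σ ht; rwa [map_mul, map_ofNat, map_one] at this
    exact mul_right_cancel₀ h2.ne_zero (by rw [h1, ht])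
  rw [hmax, Ideal.span_singleton_pow, Ideal.mem_span_singleton'] at hm
  obtain ⟨r, rfl⟩ := hm
  -- fixed representative `r₀ ≡ r (mod 𝔪)` and the anti-fixed `c = ϖ^{2j+1} r₀`
  set r₀ := (r + σ r) * t with hr₀
  have hσr₀ : σ r₀ = r₀ := by rw [hr₀, map_mul, map_add, hσ, hσt, add_comm]
  have hr₀r : r₀ - r ∈ maximalIdeal S := by
    have : r₀ - r = (σ r - r) * t := by rw [hr₀]; linear_combination r * ht
    rw [this]; exact Ideal.mul_mem_right _ _ (hres r)
  set c := r₀ * ϖ ^ (2 * j + 1) with hc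
  have hσpow : σ (ϖ ^ (2 * j + 1)) = -ϖ ^ (2 * j + 1) := by
    rw [map_pow, hσϖ, neg_pow, pow_succ (-1 : S), pow_mul, neg_one_sq, one_pow, one_mul, neg_one_mul]
  have hσc : σ c = -c := by rw [hc, map_mul, hσr₀, hσpow, mul_neg]
  have hcm : c ∈ maximalIdeal S ^ (2 * j + 1) := by
    rw [hmax, Ideal.span_singleton_pow]; exact Ideal.mem_span_singleton'.2 ⟨r₀, rfl⟩
  have hc1 : c ∈ maximalIdeal S := Ideal.pow_le_self (by omega) hcm
  refine ⟨1 + c, ?_, ?_, ?_⟩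
  · have := IsLocalRing.isUnit_one_sub_self_of_mem_nonunits (-c) ((IsLocalRing.mem_maximalIdeal (-c)).1 (neg_mem hc1))
    rwa [sub_neg_eq_add] at this
  · have e : σ (1 + c) - (1 + c) = -(2 * c) := by rw [map_add, map_one, hσc]; ring
    rw [e, neg_mem_iff]; exact Ideal.mul_mem_left _ _ hcm
  · have e1 : (1 + c) - σ (1 + c) = 2 * c := by rw [map_add, map_one, hσc]; ring
    have e2 : (1 + c) + σ (1 + c) = 2 := by rw [map_add, map_one, hσc]; ring
    rw [e1, e2, mul_comm (2 : S) c, mul_assoc, Ring.mul_inverse_cancel _ h2, mul_one]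
    have e3 : c - r * ϖ ^ (2 * j + 1) = ϖ ^ (2 * j + 1) * (r₀ - r) := by rw [hc]; ring
    have hϖm : ϖ ∈ maximalIdeal S := by rw [hmax]; exact Ideal.mem_span_singleton_self ϖ
    rw [e3, pow_succ (maximalIdeal S) (2 * j + 1)]
    exact Ideal.mul_mem_mul (Ideal.pow_mem_pow hϖm _) hr₀r

/-- **`|𝔪^n ∕ 𝔪^{n+1}| = |𝓀|`** as the image of `𝔪^n` in `S ∕ 𝔪^{n+1}` (`|S ∕ 𝔪^k| = |𝓀|^k`, ★ `natCard_quotient_maximalIdeal_pow`, and the third isomorphism theorem).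
[cite: Serre1979, Ch. II §3 Prop. 5] -/
theorem natCard_map_mk_maximalIdeal_pow [Finite (ResidueField S)] (n : ℕ) :
    Nat.card ↥((maximalIdeal S ^ n).map (Ideal.Quotient.mk (maximalIdeal S ^ (n + 1)))) = Nat.card (ResidueField S) := by
  have hle : maximalIdeal S ^ (n + 1) ≤ maximalIdeal S ^ n := Ideal.pow_le_pow_right (Nat.le_succ n)
  have h1 := Submodule.card_eq_card_quotient_mul_card ((maximalIdeal S ^ n).map (Ideal.Quotient.mk (maximalIdeal S ^ (n + 1))))
  rw [Nat.card_congr (DoubleQuot.quotQuotEquivQuotOfLE hle).toEquiv, natCard_quotient_maximalIdeal_pow, natCard_quotient_maximalIdeal_pow,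
    pow_succ, mul_comm] at h1
  haveI : Nonempty (ResidueField S) := ⟨0⟩
  have hq : 0 < Nat.card (ResidueField S) := Nat.card_pos
  exact (Nat.eq_of_mul_eq_mul_right (pow_pos hq n) h1).symm

include hres in
/-- At level `𝔪` the subgroup `{u : σ u − u ∈ 𝔪}` is ALL of `S^×` (residually trivial `σ`): index `1 = q^0`. [cite: Flicker1998UnitaryFL, Prop. 7 p. 84] -/
theorem index_comap_eqLocus_one_eq_one :
    (((Units.map (Ideal.quotientMap (maximalIdeal S ^ 1) σ (maximalIdeal_pow_le_comap σ hσ 1)).toMonoidHom).eqLocus (MonoidHom.id _)).comap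
        (Units.map (Ideal.Quotient.mk (maximalIdeal S ^ 1)).toMonoidHom)).index = 1 := by
  rw [Subgroup.index_eq_one, eq_top_iff]
  intro u _
  rw [mem_comap_eqLocus_iff σ hσ 1 u, pow_one]
  exact hres u

include hσ hres hϖ hσϖ h2 in
/-- **One step of the filtration**: `[{σu ≡ u (𝔪^{2j+1})} : {σu ≡ u (𝔪^{2j+3})}] = |𝓀|` — the twisted logarithm `u ↦ w(u) mod 𝔪^{2j+2}` is a homomorphism onto
`𝔪^{2j+1} ∕ 𝔪^{2j+2}` (§2, `exists_isUnit_twistedLog_sub_mem`) with kernel `{σu ≡ u (𝔪^{2j+2})} = {σu ≡ u (𝔪^{2j+3})}` (parity).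
[cite: Flicker1998UnitaryFL, Prop. 7 p. 84] [cite: Serre1979, Ch. IV §1 Prop. 3, Ch. V §1] -/
theorem relIndex_comap_eqLocus_odd [Finite (ResidueField S)] (j : ℕ) :
    (((Units.map (Ideal.quotientMap (maximalIdeal S ^ (2 * j + 3)) σ (maximalIdeal_pow_le_comap σ hσ (2 * j + 3))).toMonoidHom).eqLocus
          (MonoidHom.id _)).comap (Units.map (Ideal.Quotient.mk (maximalIdeal S ^ (2 * j + 3))).toMonoidHom)).relIndex
      (((Units.map (Ideal.quotientMap (maximalIdeal S ^ (2 * j + 1)) σ (maximalIdeal_pow_le_comap σ hσ (2 * j + 1))).toMonoidHom).eqLocus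
          (MonoidHom.id _)).comap (Units.map (Ideal.Quotient.mk (maximalIdeal S ^ (2 * j + 1))).toMonoidHom)) = Nat.card (ResidueField S) := by
  classical
  set V₁ := (((Units.map (Ideal.quotientMap (maximalIdeal S ^ (2 * j + 1)) σ (maximalIdeal_pow_le_comap σ hσ (2 * j + 1))).toMonoidHom).eqLocus
          (MonoidHom.id _)).comap (Units.map (Ideal.Quotient.mk (maximalIdeal S ^ (2 * j + 1))).toMonoidHom)) with hV₁
  set V₃ := (((Units.map (Ideal.quotientMap (maximalIdeal S ^ (2 * j + 3)) σ (maximalIdeal_pow_le_comap σ hσ (2 * j + 3))).toMonoidHom).eqLocus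
          (MonoidHom.id _)).comap (Units.map (Ideal.Quotient.mk (maximalIdeal S ^ (2 * j + 3))).toMonoidHom)) with hV₃
  have hmem₁ : ∀ u : Sˣ, u ∈ V₁ ↔ σ (u : S) - u ∈ maximalIdeal S ^ (2 * j + 1) := fun u => mem_comap_eqLocus_iff σ hσ _ u
  have hmem₃ : ∀ u : Sˣ, u ∈ V₃ ↔ σ (u : S) - u ∈ maximalIdeal S ^ (2 * j + 3) := fun u => mem_comap_eqLocus_iff σ hσ _ u
  set I := maximalIdeal S ^ (2 * j + 2) with hI
  set K : Ideal (S ⧸ I) := (maximalIdeal S ^ (2 * j + 1)).map (Ideal.Quotient.mk I) with hK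
  -- the twisted logarithm on `V₁`, valued in `K = 𝔪^{2j+1} ∕ 𝔪^{2j+2}`
  have hw : ∀ u : ↥V₁, ((u : Sˣ) - σ (u : Sˣ) : S) * Ring.inverse ((u : Sˣ) + σ (u : Sˣ)) ∈ maximalIdeal S ^ (2 * j + 1) := fun u =>
    (sub_map_mul_inverse_mem_pow_iff σ hres h2 (Units.isUnit (u : Sˣ)) _).2 ((hmem₁ u).1 u.2)
  let ψ : ↥V₁ →* Multiplicative ↥K :=
    { toFun := fun u => Multiplicative.ofAdd ⟨Ideal.Quotient.mk I (((u : Sˣ) - σ (u : Sˣ) : S) * Ring.inverse ((u : Sˣ) + σ (u : Sˣ))),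
        Ideal.mem_map_of_mem _ (hw u)⟩
      map_one' := by
        change Multiplicative.ofAdd _ = Multiplicative.ofAdd 0
        congr 1
        ext
        simp
      map_mul' := fun u u' => by
        change Multiplicative.ofAdd _ = Multiplicative.ofAdd (_ + _)
        congr 1
        ext
        change Ideal.Quotient.mk I _ = Ideal.Quotient.mk I _ + Ideal.Quotient.mk I _
        rw [← map_add, Ideal.Quotient.mk_eq_mk_iff_sub_mem]
        have h := twistedLog_mul_sub_mem σ hres h2 (Units.isUnit (u : Sˣ)) (Units.isUnit (u' : Sˣ)) (2 * j + 1) ((hmem₁ u).1 u.2) ((hmem₁ u').1 u'.2)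
        have hle : maximalIdeal S ^ (2 * (2 * j + 1)) ≤ I := Ideal.pow_le_pow_right (by omega)
        simpa only [Subgroup.coe_mul, Units.val_mul, sub_sub] using hle h }
  -- kernel = `V₃ ⊓ V₁`
  have hker : ψ.ker = V₃.subgroupOf V₁ := by
    ext u
    rw [MonoidHom.mem_ker, Subgroup.mem_subgroupOf, hmem₃]
    change Multiplicative.ofAdd _ = Multiplicative.ofAdd 0 ↔ _
    rw [Multiplicative.ofAdd.injective.eq_iff, Subtype.ext_iff]
    change Ideal.Quotient.mk I _ = 0 ↔ _
    rw [Ideal.Quotient.eq_zero_iff_mem, sub_map_mul_inverse_mem_pow_iff σ hres h2 (Units.isUnit (u : Sˣ))]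
    exact ⟨map_sub_self_mem_pow_succ_of_even σ hσ hres hϖ hσϖ h2 _ j, fun h => Ideal.pow_le_pow_right (by omega) h⟩
  -- surjective
  have hsurj : Function.Surjective ψ := by
    intro z
    obtain ⟨m, hm, hmz⟩ := (Ideal.mem_map_iff_of_surjective (Ideal.Quotient.mk I) Ideal.Quotient.mk_surjective).1 (Multiplicative.toAdd z).2
    obtain ⟨u, hu, hV, hwm⟩ := exists_isUnit_twistedLog_sub_mem σ hσ hres hϖ hσϖ h2 j hm
    refine ⟨⟨hu.unit, (hmem₁ _).2 (by simpa using hV)⟩, ?_⟩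
    apply Multiplicative.toAdd.injective
    ext
    change Ideal.Quotient.mk I _ = ((Multiplicative.toAdd z : ↥K) : S ⧸ I)
    rw [← hmz, Ideal.Quotient.mk_eq_mk_iff_sub_mem]
    simpa using hwm
  have h1 := Subgroup.index_ker ψ
  rw [hker, MonoidHom.range_eq_top_of_surjective _ hsurj, Subgroup.card_top] at h1
  rw [Subgroup.relIndex, h1]
  change Nat.card ↥K = _
  exact natCard_map_mk_maximalIdeal_pow (2 * j + 1)

include hσ hres hϖ hσϖ h2 in
/-- **THE RAMIFIED ORDER UNIT INDEX `[S^× : {u : σ u ≡ u (𝔪^{2j+1})}] = q^j`** (`S` a DVR with residually trivial involution `σ`, anti-fixed uniformiser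
`σ ϖ = −ϖ`, `2 ∈ S^×`, `|𝓀| = q`).  In coordinates `S = R ⊕ R ϖ` (`R = S^σ`) the subgroup is `(R + ϖ_R^j S)^× = R_L(j)^×`, so this is Mars' index
`[R_L^× : R_L(j)^×] = q^{j+1−f}(q^f − 1)∕(q − 1) = q^j` for `e = 2, f = 1` — the H-side weight of the RAMIFIED torus, `Σ_{j ≤ N} q^j = (q^{N+1} − 1)∕(q − 1)`
(Flicker §6 REMARK; the (F9)-ramified ∕ (F11-d) value). [cite: Flicker1998UnitaryFL, Prop. 7 p. 84; §6 p. 95 REMARK] [cite: Serre1979, Ch. IV §1 Prop. 3] -/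
theorem index_comap_eqLocus_odd_eq_pow [Finite (ResidueField S)] {q : ℕ} (hq : Nat.card (ResidueField S) = q) (j : ℕ) :
    (((Units.map (Ideal.quotientMap (maximalIdeal S ^ (2 * j + 1)) σ (maximalIdeal_pow_le_comap σ hσ (2 * j + 1))).toMonoidHom).eqLocus
          (MonoidHom.id _)).comap (Units.map (Ideal.Quotient.mk (maximalIdeal S ^ (2 * j + 1))).toMonoidHom)).index = q ^ j := by
  induction j with
  | zero => simpa using index_comap_eqLocus_one_eq_one σ hσ hres
  | succ j ih =>
    have hle : (((Units.map (Ideal.quotientMap (maximalIdeal S ^ (2 * (j + 1) + 1)) σ (maximalIdeal_pow_le_comap σ hσ (2 * (j + 1) + 1))).toMonoidHom).eqLocus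
          (MonoidHom.id _)).comap (Units.map (Ideal.Quotient.mk (maximalIdeal S ^ (2 * (j + 1) + 1))).toMonoidHom)) ≤
        (((Units.map (Ideal.quotientMap (maximalIdeal S ^ (2 * j + 1)) σ (maximalIdeal_pow_le_comap σ hσ (2 * j + 1))).toMonoidHom).eqLocus
          (MonoidHom.id _)).comap (Units.map (Ideal.Quotient.mk (maximalIdeal S ^ (2 * j + 1))).toMonoidHom)) := by
      intro u hu
      rw [mem_comap_eqLocus_iff σ hσ] at hu ⊢
      exact Ideal.pow_le_pow_right (by omega) hu
    have h := Subgroup.relIndex_mul_index hle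
    rw [ih, show 2 * (j + 1) + 1 = 2 * j + 3 by ring, relIndex_comap_eqLocus_odd σ hσ hres hϖ hσϖ h2 j, hq] at h
    rw [show 2 * (j + 1) + 1 = 2 * j + 3 by ring, ← h, pow_succ, mul_comm]

end Index

end Literature.NumberTheory.LocalFields.RamifiedQuadraticOrder
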